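import Mathlib
import Summits.Ventures.PercRepro2.SLevelCDLeaf
import Summits.Ventures.PercRepro2.CaseOnePendantAny
import Summits.Ventures.PercRepro2.RVBridge

/-!
# (CD) at a general threshold pair, and the pendant reduction: a leaf `a₃` at ANY vertex `v` reduces
(CD) to (CD) for the mark `v` in the world where the leaf edge is sure, at the thresholds of `a₃`
(blind cell PercRepro2, mine-c g12; the (CD) twin of p1 g13's (K8) `zSplitII_of_leaf_at`)

`phiT c₀ c₁ S = 1[a₃ ∈ S] · (c₁ h_o(S) − c₀)` (so `phi = phiT D_o D`) and **`CDT c₀ c₁`** := `covS F (phiT c₀ c₁) ≤ 0`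
for every increasing `F`; `CD ↔ CDT D_o D` (`cd_iff_cdT`); `covS_phiT_eq_omega` is the ω-form at a general
threshold pair. **`cd_of_leaf_at`**: if `a₃` is a leaf at `v` through `e₀` (`a₁, a₂ ≠ a₃`) and
`CDT (p[e₀ ↦ 1]) v (D_o(a₃)) (D(a₃))` holds — (CD) for the mark `v` in the world where `e₀` is sure, at
the PD-thresholds of `a₃` — then `CD p a₃`. Proof: `{a₃ ∈ C₁} = {e₀ open} ∩ {v ∈ C₁}` (p1's
`indicator_leaf_at`), so every case-1 term of the ω-form is `p(e₀)` times the corresponding term of the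
mark `v` in the pinned world (`expect_mul_openEdge`, `expect_update_one`), `Q` and `P(Q)` ignore `e₀`,
`E[F(C₁) 1_Q] ≤ E_{p[e₀↦1]}[F(C₁) 1_Q]` by monotonicity, and the odds lemma (`J1RV.oddsGap_nonneg`)
gives the sign that makes the replacement safe. With the threshold mixing `D(a₃) = (1 − p₀)P(Q) + p₀ D(v)`,
`D_o(a₃) = (1 − p₀) P(Q, o ∈ U) + p₀ D_o(v)` (p1's `Dpd_leaf_at` / `Dpdo_leaf_at`) and the affinity of
`covS F (phiT c₀ c₁)` in `(c₀, c₁)`, this is (CD)(v) ∧ (CD at the Q-threshold)(v) ⟹ (CD)(a₃) — stated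
here as `cd_of_leaf_at`; the convex-combination step is `cdT_of_two` . Nothing beyond is claimed. -/

namespace Summit.Ventures.PercRepro2

open UnionCluster

namespace SLevel

section ThresholdDefs

variable {V : Type*} {E : Type*} [Fintype E] [DecidableEq E] {R : Type*} [Field R]

/-- `φ` at a general threshold pair: `phiT c₀ c₁ S = 1[a₃ ∈ S] · (c₁ · h_o(S) − c₀)`. -/
noncomputable def phiT (p : E → R) (ends : E → Sym2 V) (o a₂ a₃ : V) (c₀ c₁ : R) (S : Set V) : R :=
  indS a₃ S * (c₁ * hS p ends a₂ o S - c₀)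

/-- `phi = phiT D_o D`. -/
lemma phi_eq_phiT (p : E → R) (ends : E → Sym2 V) (o a₁ a₂ a₃ : V) :
    phi p ends o a₁ a₂ a₃ =
      phiT p ends o a₂ a₃ (CovForm.Do p ends o a₁ a₂ a₃) (prob p (PDEvent ends a₁ a₂ a₃)) := rfl

end ThresholdDefs

section ThresholdProp

variable {V : Type*} {E : Type*} [Fintype E] [DecidableEq E] [Fintype V] [DecidableEq V]
  {R : Type*} [Field R] [LinearOrder R] [IsStrictOrderedRing R]

variable (p : E → R) (ends : E → Sym2 V) (o a₁ a₂ a₃ : V)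

/-- **(CD) at a general threshold pair** `(c₀, c₁)`: `covS F (phiT c₀ c₁) ≤ 0` for every increasing `F`.
A definition only; `CD = CDT D_o D`. -/
def CDT (c₀ c₁ : R) : Prop :=
  ∀ F : Set V → R, Monotone F → covS p ends a₁ a₂ F (phiT p ends o a₂ a₃ c₀ c₁) ≤ 0

omit [Fintype V] [DecidableEq V] [IsStrictOrderedRing R] in
/-- `CD ↔ CDT D_o D`. -/
lemma cd_iff_cdT :
    CD p ends o a₁ a₂ a₃ ↔
      CDT p ends o a₁ a₂ a₃ (CovForm.Do p ends o a₁ a₂ a₃) (prob p (PDEvent ends a₁ a₂ a₃)) :=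
  Iff.rfl

omit [Fintype V] [DecidableEq V] [LinearOrder R] [IsStrictOrderedRing R] in
/-- `covS F (phiT · ·)` is affine in the threshold pair. -/
lemma covS_phiT_affine (F : Set V → R) (c₀ c₁ d₀ d₁ t : R) :
    covS p ends a₁ a₂ F (phiT p ends o a₂ a₃ (t * c₀ + (1 - t) * d₀) (t * c₁ + (1 - t) * d₁)) =
      t * covS p ends a₁ a₂ F (phiT p ends o a₂ a₃ c₀ c₁) +
        (1 - t) * covS p ends a₁ a₂ F (phiT p ends o a₂ a₃ d₀ d₁) := by
  unfold covS phiT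
  have e1 : ∀ (a b : R) (g : Config E → R), expect p (fun ω => g ω * (a * indS a₃ (cluster ends ω a₁) *
      (c₁ * hS p ends a₂ o (cluster ends ω a₁) - c₀) + b * indS a₃ (cluster ends ω a₁) *
      (d₁ * hS p ends a₂ o (cluster ends ω a₁) - d₀)) * (avoidAll ends a₂ {a₁}).indicator 1 ω) =
      a * expect p (fun ω => g ω * (indS a₃ (cluster ends ω a₁) *
        (c₁ * hS p ends a₂ o (cluster ends ω a₁) - c₀)) * (avoidAll ends a₂ {a₁}).indicator 1 ω) +
      b * expect p (fun ω => g ω * (indS a₃ (cluster ends ω a₁) *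
        (d₁ * hS p ends a₂ o (cluster ends ω a₁) - d₀)) * (avoidAll ends a₂ {a₁}).indicator 1 ω) := by
    intro a b g
    rw [← expect_const_mul, ← expect_const_mul, ← expect_add]
    congr 1; funext ω; simp only [Pi.add_apply]; ring
  have x1 := e1 t (1 - t) (fun ω => F (cluster ends ω a₁))
  have x2 := e1 t (1 - t) (fun _ => (1 : R))
  simp only [one_mul] at x2
  have y1 : (fun ω => F (cluster ends ω a₁) * (indS a₃ (cluster ends ω a₁) *
      ((t * c₁ + (1 - t) * d₁) * hS p ends a₂ o (cluster ends ω a₁) - (t * c₀ + (1 - t) * d₀))) *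
      (avoidAll ends a₂ {a₁}).indicator 1 ω) =
      fun ω => F (cluster ends ω a₁) * (t * indS a₃ (cluster ends ω a₁) *
        (c₁ * hS p ends a₂ o (cluster ends ω a₁) - c₀) + (1 - t) * indS a₃ (cluster ends ω a₁) *
        (d₁ * hS p ends a₂ o (cluster ends ω a₁) - d₀)) * (avoidAll ends a₂ {a₁}).indicator 1 ω := by
    funext ω; ring
  have y2 : (fun ω => indS a₃ (cluster ends ω a₁) *
      ((t * c₁ + (1 - t) * d₁) * hS p ends a₂ o (cluster ends ω a₁) - (t * c₀ + (1 - t) * d₀)) *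
      (avoidAll ends a₂ {a₁}).indicator 1 ω) =
      fun ω => (t * indS a₃ (cluster ends ω a₁) *
        (c₁ * hS p ends a₂ o (cluster ends ω a₁) - c₀) + (1 - t) * indS a₃ (cluster ends ω a₁) *
        (d₁ * hS p ends a₂ o (cluster ends ω a₁) - d₀)) * (avoidAll ends a₂ {a₁}).indicator 1 ω := by
    funext ω; ring
  rw [y1, y2, x1, x2]
  ring

omit [Fintype V] [DecidableEq V] in
/-- `CDT` at a convex combination of two threshold pairs. -/
theorem cdT_of_two {c₀ c₁ d₀ d₁ t : R} (ht0 : 0 ≤ t) (ht1 : t ≤ 1)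
    (hc : CDT p ends o a₁ a₂ a₃ c₀ c₁) (hd : CDT p ends o a₁ a₂ a₃ d₀ d₁) :
    CDT p ends o a₁ a₂ a₃ (t * c₀ + (1 - t) * d₀) (t * c₁ + (1 - t) * d₁) := by
  intro F hF
  rw [covS_phiT_affine]
  have h1 := hc F hF
  have h2 := hd F hF
  nlinarith [mul_nonpos_of_nonneg_of_nonpos ht0 h1,
    mul_nonpos_of_nonneg_of_nonpos (sub_nonneg.2 ht1) h2]

end ThresholdProp

section Reduction

variable {V : Type*} {E : Type*} [Fintype E] [DecidableEq E] [Fintype V] [DecidableEq V]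
  {R : Type*} [Field R] [LinearOrder R] [IsStrictOrderedRing R]

variable (p : E → R) (ends : E → Sym2 V) (o a₁ a₂ a₃ : V)

local notation3 "Q" => avoidAll ends a₂ {a₁}
local notation3 "𝟙Q" => (avoidAll ends a₂ {a₁}).indicator (1 : Config E → R)
local notation3 "𝟙f" => (connEvent ends a₂ o).indicator (1 : Config E → R)
local notation3 "D" => prob p (PDEvent ends a₁ a₂ a₃)
local notation3 "Dₒ" => CovForm.Do p ends o a₁ a₂ a₃

omit [DecidableEq V] [LinearOrder R] [IsStrictOrderedRing R] in
/-- **The ω-form of `covS F (phiT c₀ c₁)`** at a general threshold pair (the `phi` case is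
`covS_phi_eq_omega`). -/
theorem covS_phiT_eq_omega (F : Set V → R) (c₀ c₁ : R) :
    covS p ends a₁ a₂ F (phiT p ends o a₂ a₃ c₀ c₁) =
      prob p Q * (c₁ * expect p (fun ω => F (cluster ends ω a₁) *
            (connEvent ends a₁ a₃).indicator 1 ω * 𝟙f ω * 𝟙Q ω) -
          c₀ * expect p (fun ω => F (cluster ends ω a₁) * (connEvent ends a₁ a₃).indicator 1 ω * 𝟙Q ω)) -
        expect p (fun ω => F (cluster ends ω a₁) * 𝟙Q ω) *
          (c₁ * expect p (fun ω => (connEvent ends a₁ a₃).indicator 1 ω * 𝟙f ω * 𝟙Q ω) -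
            c₀ * expect p (fun ω => (connEvent ends a₁ a₃).indicator 1 ω * 𝟙Q ω)) := by
  have t1 := tower_F p ends o a₁ a₂ a₃ F
  have t2 := tower_F p ends o a₁ a₂ a₃ (fun _ => (1 : R))
  simp only [one_mul] at t2
  rw [t1, t2]
  unfold covS phiT
  have x1 : expect p (fun ω => F (cluster ends ω a₁) *
      (indS a₃ (cluster ends ω a₁) * (c₁ * hS p ends a₂ o (cluster ends ω a₁) - c₀)) * 𝟙Q ω) =
      c₁ * expect p (fun ω => F (cluster ends ω a₁) * (connEvent ends a₁ a₃).indicator 1 ω *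
          hS p ends a₂ o (cluster ends ω a₁) * 𝟙Q ω) -
        c₀ * expect p (fun ω => F (cluster ends ω a₁) * (connEvent ends a₁ a₃).indicator 1 ω * 𝟙Q ω) := by
    rw [← expect_const_mul, ← expect_const_mul, ← expect_sub]
    congr 1; funext ω
    simp only [Pi.sub_apply, indS]
    rw [CaseOne.ind_cluster_eq ends a₁ a₃ ω]
    ring
  have x2 : expect p (fun ω => indS a₃ (cluster ends ω a₁) *
      (c₁ * hS p ends a₂ o (cluster ends ω a₁) - c₀) * 𝟙Q ω) =
      c₁ * expect p (fun ω => (connEvent ends a₁ a₃).indicator 1 ω * hS p ends a₂ o (cluster ends ω a₁) *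
          𝟙Q ω) -
        c₀ * expect p (fun ω => (connEvent ends a₁ a₃).indicator 1 ω * 𝟙Q ω) := by
    rw [← expect_const_mul, ← expect_const_mul, ← expect_sub]
    congr 1; funext ω
    simp only [Pi.sub_apply, indS]
    rw [CaseOne.ind_cluster_eq ends a₁ a₃ ω]
    ring
  rw [x1, x2]

variable {ends a₁ a₂ a₃}

omit [Fintype E] [Fintype V] [DecidableEq V] [LinearOrder R] [IsStrictOrderedRing R] in
/-- `𝟙Q` ignores the leaf edge of a leaf `a₃` at any `v` (`a₁, a₂ ≠ a₃`). -/
lemma Q_indicator_update_at {v : V} {e₀ : E} (hl : CaseOne.IsLeafAt ends v a₃ e₀) (h1 : a₁ ≠ a₃)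
    (h2 : a₂ ≠ a₃) (ω : Config E) (c : Bool) : 𝟙Q (Function.update ω e₀ c) = 𝟙Q ω := by
  have key : ∀ ω' : Config E, ω' ∈ Q ↔ Function.update ω' e₀ false ∈ Q := by
    intro ω'
    simp only [mem_avoidAll, Finset.mem_singleton, forall_eq]
    rw [CaseOne.conn_iff_update_of_leaf hl ω' h2 h1]
  have hm : Function.update ω e₀ c ∈ Q ↔ ω ∈ Q := by
    rw [key (Function.update ω e₀ c), Function.update_idem, key ω]
  by_cases h : ω ∈ Q
  · rw [Set.indicator_of_mem h, Set.indicator_of_mem (hm.2 h)]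
    rfl
  · rw [Set.indicator_of_notMem h, Set.indicator_of_notMem (fun h' => h (hm.1 h'))]

variable (ends a₁ a₂ a₃)

/-- **The pendant reduction of (CD)**: if `a₃` is a leaf at `v` through `e₀` (`a₁, a₂ ≠ a₃`) and
`CDT` holds for the mark `v` in the world `p[e₀ ↦ 1]` at the PD-thresholds `(D_o(a₃), D(a₃))` of `a₃`,
then `CD` holds for `a₃`. -/
theorem cd_of_leaf_at (hp : IsProbVec p) {v : V} {e₀ : E} (hl : CaseOne.IsLeafAt ends v a₃ e₀)
    (h1 : a₁ ≠ a₃) (h2 : a₂ ≠ a₃)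
    (hv : CDT (Function.update p e₀ 1) ends o a₁ a₂ v (CovForm.Do p ends o a₁ a₂ a₃)
      (prob p (PDEvent ends a₁ a₂ a₃))) :
    CD p ends o a₁ a₂ a₃ := by
  intro F hF
  rw [covS_phi_eq_omega]
  set p' := Function.update p e₀ 1 with hp'def
  have hE' : ∀ g : Config E → R, expect p' g = expect p (fun ω => g (Function.update ω e₀ true)) :=
    fun g => expect_update_one p g e₀
  have hQu : ∀ (ω : Config E) (c : Bool), 𝟙Q (Function.update ω e₀ c) = 𝟙Q ω :=
    fun ω c => Q_indicator_update_at (R := R) hl h1 h2 ω c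
  have hind : ∀ ω : Config E, (connEvent ends a₁ a₃).indicator (1 : Config E → R) ω =
      (openEdge e₀).indicator 1 ω * (connEvent ends a₁ v).indicator 1 ω :=
    fun ω => CaseOne.indicator_leaf_at hl h1 ω
  -- the case-1 terms: `p(e₀)` times the `v`-terms in `p'`
  have hE1 : expect p (fun ω => F (cluster ends ω a₁) * (connEvent ends a₁ a₃).indicator 1 ω *
      𝟙f ω * 𝟙Q ω) = p e₀ * expect p' (fun ω => F (cluster ends ω a₁) *
        (connEvent ends a₁ v).indicator 1 ω * 𝟙f ω * 𝟙Q ω) := by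
    rw [hE', show (fun ω => F (cluster ends ω a₁) * (connEvent ends a₁ a₃).indicator (1 : Config E → R) ω *
        𝟙f ω * 𝟙Q ω) = fun ω => (F (cluster ends ω a₁) * (connEvent ends a₁ v).indicator 1 ω *
        𝟙f ω * 𝟙Q ω) * (openEdge e₀).indicator 1 ω from by funext ω; rw [hind]; ring,
      expect_mul_openEdge p e₀]
  have hE2 : expect p (fun ω => F (cluster ends ω a₁) * (connEvent ends a₁ a₃).indicator 1 ω *
      𝟙Q ω) = p e₀ * expect p' (fun ω => F (cluster ends ω a₁) *
        (connEvent ends a₁ v).indicator 1 ω * 𝟙Q ω) := by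
    rw [hE', show (fun ω => F (cluster ends ω a₁) * (connEvent ends a₁ a₃).indicator (1 : Config E → R) ω *
        𝟙Q ω) = fun ω => (F (cluster ends ω a₁) * (connEvent ends a₁ v).indicator 1 ω * 𝟙Q ω) *
        (openEdge e₀).indicator 1 ω from by funext ω; rw [hind]; ring,
      expect_mul_openEdge p e₀]
  have hE4 : expect p (fun ω => (connEvent ends a₁ a₃).indicator 1 ω * 𝟙f ω * 𝟙Q ω) =
      p e₀ * expect p' (fun ω => (connEvent ends a₁ v).indicator 1 ω * 𝟙f ω * 𝟙Q ω) := by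
    rw [hE', show (fun ω => (connEvent ends a₁ a₃).indicator (1 : Config E → R) ω * 𝟙f ω * 𝟙Q ω) =
        fun ω => ((connEvent ends a₁ v).indicator 1 ω * 𝟙f ω * 𝟙Q ω) * (openEdge e₀).indicator 1 ω from by
        funext ω; rw [hind]; ring,
      expect_mul_openEdge p e₀]
  have hE5 : expect p (fun ω => (connEvent ends a₁ a₃).indicator 1 ω * 𝟙Q ω) =
      p e₀ * expect p' (fun ω => (connEvent ends a₁ v).indicator 1 ω * 𝟙Q ω) := by
    rw [hE', show (fun ω => (connEvent ends a₁ a₃).indicator (1 : Config E → R) ω * 𝟙Q ω) =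
        fun ω => ((connEvent ends a₁ v).indicator 1 ω * 𝟙Q ω) * (openEdge e₀).indicator 1 ω from by
        funext ω; rw [hind]; ring,
      expect_mul_openEdge p e₀]
  -- `P(Q)` ignores `e₀`
  have hPQ : prob p Q = prob p' Q := by
    rw [prob_eq_expect_indicator, prob_eq_expect_indicator, hE', expect_split p e₀]
    have t1 : (fun ω => 𝟙Q (Function.update ω e₀ true)) = 𝟙Q := by funext ω; exact hQu ω true
    have t2 : (fun ω => 𝟙Q (Function.update ω e₀ false)) = 𝟙Q := by funext ω; exact hQu ω false
    rw [t1, t2]; ring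
  -- `E[F 1_Q] ≤ E_{p'}[F 1_Q]` by monotonicity
  have hB : expect p (fun ω => F (cluster ends ω a₁) * 𝟙Q ω) ≤
      expect p' (fun ω => F (cluster ends ω a₁) * 𝟙Q ω) := by
    rw [hE', expect_split p e₀ (fun ω => F (cluster ends ω a₁) * 𝟙Q ω)]
    have hmono : expect p (fun ω => F (cluster ends (Function.update ω e₀ false) a₁) *
        𝟙Q (Function.update ω e₀ false)) ≤
        expect p (fun ω => F (cluster ends (Function.update ω e₀ true) a₁) *
          𝟙Q (Function.update ω e₀ true)) := by
      refine expect_mono hp fun ω => ?_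
      rw [hQu ω false, hQu ω true]
      exact mul_le_mul_of_nonneg_right (hF (cluster_mono (update_false_le_update_true ω e₀) a₁))
        (Set.indicator_apply_nonneg fun _ => zero_le_one)
    nlinarith [hp.nonneg e₀, hp.le_one e₀]
  -- the odds lemma for `a₃`: `D · P(Q, a₃∈C₁, o∈C₂) ≤ D_o · P(Q, a₃∈C₁)`
  have hodds : D * expect p (fun ω => (connEvent ends a₁ a₃).indicator 1 ω * 𝟙f ω * 𝟙Q ω) ≤
      Dₒ * expect p (fun ω => (connEvent ends a₁ a₃).indicator 1 ω * 𝟙Q ω) := by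
    have h := J1RV.oddsGap_nonneg p hp ends o a₁ a₂ a₃
    unfold J1RV.pT1 J1RV.pT1o at h
    rw [prob_eq_expect_indicator p (Q ∩ connEvent ends a₁ a₃),
      prob_eq_expect_indicator p (Q ∩ connEvent ends a₁ a₃ ∩ connEvent ends a₂ o)] at h
    have s1 : (Q ∩ connEvent ends a₁ a₃).indicator (1 : Config E → R) =
        fun ω => (connEvent ends a₁ a₃).indicator 1 ω * 𝟙Q ω := by
      funext ω; rw [← CaseOne.ind_mul, mul_comm]
    have s2 : (Q ∩ connEvent ends a₁ a₃ ∩ connEvent ends a₂ o).indicator (1 : Config E → R) =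
        fun ω => (connEvent ends a₁ a₃).indicator 1 ω * 𝟙f ω * 𝟙Q ω := by
      funext ω; rw [← CaseOne.ind_mul, ← CaseOne.ind_mul]; ring
    rw [s1, s2] at h
    linarith
  -- conclude
  rw [hE1, hE2, hE4, hE5]
  have hcov := hv F hF
  rw [covS_phiT_eq_omega] at hcov
  rw [hE4, hE5] at hodds
  rcases eq_or_lt_of_le (hp.nonneg e₀) with h0 | h0
  · rw [← h0]; ring_nf; exact le_refl _
  · have hN : D * expect p' (fun ω => (connEvent ends a₁ v).indicator 1 ω * 𝟙f ω * 𝟙Q ω) -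
        Dₒ * expect p' (fun ω => (connEvent ends a₁ v).indicator 1 ω * 𝟙Q ω) ≤ 0 := by
      have := hodds
      nlinarith
    have hB' := mul_le_mul_of_nonpos_right hB hN
    rw [hPQ]
    nlinarith [hcov, hB', hp.nonneg e₀]

variable {ends a₁ a₂ a₃}

omit [Fintype E] [Fintype V] [DecidableEq V] [LinearOrder R] [IsStrictOrderedRing R] in
/-- A connection event between vertices `≠ a₃` ignores the leaf edge. -/
lemma mem_connEvent_update_iff {v : V} {e₀ : E} (hl : CaseOne.IsLeafAt ends v a₃ e₀) {u w : V}
    (hu : u ≠ a₃) (hw : w ≠ a₃) (ω : Config E) (c : Bool) :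
    Function.update ω e₀ c ∈ connEvent ends u w ↔ ω ∈ connEvent ends u w := by
  simp only [mem_connEvent]
  rw [CaseOne.conn_iff_update_of_leaf hl ω hu hw,
    CaseOne.conn_iff_update_of_leaf hl (Function.update ω e₀ c) hu hw, Function.update_idem]

omit [Fintype V] [DecidableEq V] [LinearOrder R] [IsStrictOrderedRing R] in
/-- The probability of an event ignoring `e₀` is the same under `p[e₀ ↦ 1]`. -/
lemma prob_update_one_of_ignore {e₀ : E} (A : Set (Config E))
    (hA : ∀ ω, Function.update ω e₀ true ∈ A ↔ ω ∈ A) :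
    prob (Function.update p e₀ 1) A = prob p A := by
  rw [prob_eq_expect_indicator, prob_eq_expect_indicator, expect_update_one]
  congr 1; funext ω
  by_cases h : ω ∈ A
  · rw [Set.indicator_of_mem h, Set.indicator_of_mem ((hA ω).2 h)]
    rfl
  · rw [Set.indicator_of_notMem h, Set.indicator_of_notMem (fun h' => h ((hA ω).1 h'))]

variable (ends a₁ a₂ a₃)

/-- **CD(v) ∧ CD_Q(v) ⟹ CD(a₃)** for a leaf `a₃` at `v` (`o, a₁, a₂ ≠ a₃`): the (CD) twin of p1's
`zSplitII_of_leaf_at`. `CD_Q(v)` is `CDT` for `v` at the Q-threshold pair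
`(P(Q, o ∈ C₁ ∪ C₂), P(Q))`; both hypotheses are taken in the world `p[e₀ ↦ 1]`. -/
theorem cd_of_leaf_at_of_cd_of_cdQ (hp : IsProbVec p) {v : V} {e₀ : E}
    (hl : CaseOne.IsLeafAt ends v a₃ e₀) (ho : o ≠ a₃) (h1 : a₁ ≠ a₃) (h2 : a₂ ≠ a₃)
    (hcd : CD (Function.update p e₀ 1) ends o a₁ a₂ v)
    (hQ : CDT (Function.update p e₀ 1) ends o a₁ a₂ v
      (prob (Function.update p e₀ 1) ((connEvent ends a₁ o ∪ connEvent ends a₂ o) ∩ (connEvent ends a₁ a₂)ᶜ))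
      (prob (Function.update p e₀ 1) (connEvent ends a₁ a₂)ᶜ)) :
    CD p ends o a₁ a₂ a₃ := by
  have hv : v ≠ a₃ := hl.ne
  set p' := Function.update p e₀ 1 with hp'def
  -- the events of `v` ignore `e₀`
  have ig1 : ∀ ω : Config E, Function.update ω e₀ true ∈ PDEvent ends a₁ a₂ v ↔
      ω ∈ PDEvent ends a₁ a₂ v := by
    intro ω
    simp only [PDEvent, Dtilde, Set.mem_inter_iff, Set.mem_compl_iff, mem_inU, ← mem_connEvent]
    rw [mem_connEvent_update_iff hl h1 h2, mem_connEvent_update_iff hl hv h1,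
      mem_connEvent_update_iff hl hv h2]
  have ig2 : ∀ ω : Config E, Function.update ω e₀ true ∈ PDEvent ends a₁ a₂ v ∩ connEvent ends a₁ o ↔
      ω ∈ PDEvent ends a₁ a₂ v ∩ connEvent ends a₁ o := by
    intro ω
    simp only [Set.mem_inter_iff]
    rw [ig1, mem_connEvent_update_iff hl h1 ho]
  have ig3 : ∀ ω : Config E, Function.update ω e₀ true ∈ PDEvent ends a₁ a₂ v ∩ connEvent ends a₂ o ↔
      ω ∈ PDEvent ends a₁ a₂ v ∩ connEvent ends a₂ o := by
    intro ω
    simp only [Set.mem_inter_iff]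
    rw [ig1, mem_connEvent_update_iff hl h2 ho]
  have ig4 : ∀ ω : Config E, Function.update ω e₀ true ∈
      (connEvent ends a₁ o ∪ connEvent ends a₂ o) ∩ (connEvent ends a₁ a₂)ᶜ ↔
      ω ∈ (connEvent ends a₁ o ∪ connEvent ends a₂ o) ∩ (connEvent ends a₁ a₂)ᶜ := by
    intro ω
    simp only [Set.mem_inter_iff, Set.mem_union, Set.mem_compl_iff]
    rw [mem_connEvent_update_iff hl h1 ho, mem_connEvent_update_iff hl h2 ho,
      mem_connEvent_update_iff hl h1 h2]
  have ig5 : ∀ ω : Config E, Function.update ω e₀ true ∈ (connEvent ends a₁ a₂)ᶜ ↔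
      ω ∈ (connEvent ends a₁ a₂)ᶜ := by
    intro ω
    simp only [Set.mem_compl_iff]
    rw [mem_connEvent_update_iff hl h1 h2]
  -- the thresholds of `v` agree in `p` and `p'`; those of `a₃` mix them
  have eD : prob p' (PDEvent ends a₁ a₂ v) = prob p (PDEvent ends a₁ a₂ v) :=
    prob_update_one_of_ignore p _ ig1
  have eDo : CovForm.Do p' ends o a₁ a₂ v = CovForm.Do p ends o a₁ a₂ v := by
    unfold CovForm.Do
    rw [prob_update_one_of_ignore p _ ig2, prob_update_one_of_ignore p _ ig3]
  have eQo : prob p' ((connEvent ends a₁ o ∪ connEvent ends a₂ o) ∩ (connEvent ends a₁ a₂)ᶜ) =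
      CaseOne.Dqo p ends o a₁ a₂ :=
    prob_update_one_of_ignore p _ ig4
  have eQ : prob p' (connEvent ends a₁ a₂)ᶜ = prob p (connEvent ends a₁ a₂)ᶜ :=
    prob_update_one_of_ignore p _ ig5
  have mixD : prob p (PDEvent ends a₁ a₂ a₃) =
      p e₀ * prob p (PDEvent ends a₁ a₂ v) + (1 - p e₀) * prob p (connEvent ends a₁ a₂)ᶜ := by
    have h := CaseOne.Dpd_leaf_at p hl a₁ a₂ h1 h2
    rw [J1RV.Dpd_eq, J1RV.Dpd_eq] at h
    rw [h]; ring
  have mixDo : CovForm.Do p ends o a₁ a₂ a₃ =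
      p e₀ * CovForm.Do p ends o a₁ a₂ v + (1 - p e₀) * CaseOne.Dqo p ends o a₁ a₂ := by
    have h := CaseOne.Dpdo_leaf_at p hl o a₁ a₂ ho h1 h2
    rw [J1RV.Dpdo_eq, J1RV.Dpdo_eq] at h
    rw [h]; ring
  -- assemble
  refine cd_of_leaf_at p ends o a₁ a₂ a₃ hp hl h1 h2 ?_
  rw [mixD, mixDo]
  have hcd' : CDT p' ends o a₁ a₂ v (CovForm.Do p ends o a₁ a₂ v) (prob p (PDEvent ends a₁ a₂ v)) := by
    rw [← eD, ← eDo]; exact hcd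
  have hQ' : CDT p' ends o a₁ a₂ v (CaseOne.Dqo p ends o a₁ a₂) (prob p (connEvent ends a₁ a₂)ᶜ) := by
    rw [← eQo, ← eQ]; exact hQ
  exact cdT_of_two p' ends o a₁ a₂ v (hp.nonneg e₀) (hp.le_one e₀) hcd' hQ'

end Reduction

end SLevel

end Summit.Ventures.PercRepro2
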